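import Summits.QuantumFields.BalabanUV.Beta.D1BFx.RestKernelGhostUnitJ
import Summits.QuantumFields.BalabanUV.Beta.D1BFx.PackedColumnTableMass
import Summits.QuantumFields.BalabanUV.Beta.D1BFx.GhostWordJetMass
import Summits.QuantumFields.BalabanUV.Beta.D1BFx.RestKernelFPUnit

/-!
# `BalabanUV.Beta.D1BFx.RestKernelGhostRoad` — road «BF-x» for binder row D1, slot (K), DICT-CHAIN-SPEC §2 (II) row RK-GH: **«GHOST ROWS AT THE ROAD» —
# THE TWELVE GHOST REST WORDS OF PART 7 ∕ 8 (`R₁₆` in `ghostWordK` form) AT THE ROAD's GAUGED, `n²`-RESCALED GHOST JETS ARE (5.10)-KERNELS WITH ONE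
# n-FREE CONSTANT `KG` AND ONE n-FREE RATE `κG` — THE OWNER's PART 12b BINDERS `hgh hKg hκg` DISCHARGED** («RK-GH UNIT J» `RestKernelGhostUnitJ.decay510_wordJ_uniform`
# at gan24-leaf-05 g53's letters: «G0-JET-MASS» `PackedColumnJetMass.mass_sum_wsum_colH_G₀_le` for the first ghost jet (`T := ghCur`, `mV = n²·8·C_{G₀}·(1+64∕κ)⁴·e^{σ₀}`)
# and «G0-TABLE-MASS» `PackedColumnTableMass.mass_sum_wsum_mul_colH_G₀_le` for the diagonal ghost table (`T := gh₂`, `mW = n²·8·W²·Zl 4 (κ∕32n)`, `W = (n⁴)⁻¹·C_{G₀}`,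
# rate `κ∕32`), my g18 `GhostWordJetMass.mass_ghCur_le` ∕ `mass_gh₂_le` ∕ `mass_smul_le` for the stencil masses and the `n²` scalars).

HONEST DEPENDENCY (cell records, verbatim): «continuum YM on T⁴ ⇐ BetaPertH ∧ nine spine estimates (0/9 proved); BetaPertH ⇐ (D1) ∧ (D4) ∧
CAP+tail; G-an2-4 gates asym, D1 and NE2/3/4.»  HONEST FRAMING (cell contract, verbatim): «discharging `BetaPertH` makes Bałaban's UV stability
UNCONDITIONAL — a real constructive-QFT result; it is NOT the continuum limit and NOT the Clay problem.»  THIS MODULE DISCHARGES NOTHING of the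
wall: [folklore] composition BY NAME + `Zl 4 c ≤ (1+2∕c)⁴` arithmetic; UNCONDITIONAL in the road's objects (`0 < a`, `r ∈ box 4 n` only).  It closes the LETTERS of the
ghost lane's twelve (5.10) rows at PART 7's jets; nothing of Bałaban's asserted.  No definition, no `def … : Prop`, nothing cited, 0 sorry.  0 root-level binders of row
D1 discharged (hW ∕ hR-sockets ∕ hSX-socket ∕ D1Tel ∕ D1Rep — 0); (K) NOT closed; NOT D1, NOT `BetaPertH`, NOT continuum, NOT Clay.

ABSOLUTE RULE (cell charter, verbatim): «No internally-minted statement may enter as a cited fact. Every hypothesis is either kernel-proved in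
this package or a verbatim quotation of a PUBLISHED theorem with page reference. The manuscript(s) under audit are NOT citable for their own
disputed steps — they are the thing under adjudication; programme-internal (2001/route/tribunal) claims are never citable.»

CONTENT (all [folklore]; `n = m+1`, `r ∈ box 4 n`, `κ := kappa163 4`, `σn := min (δ_PP∕8) (κ′∕16)∕n`, `σ₀ := σn·n`; the jets = the RHS of the OWNER's PART 12a
`Vgh_succ` ∕ `Wgh_succ` at a fixed in-block root): §1 `mass_ghCur_rate_le`, `mass_gh₂_plain_le` (the stencils' masses: `2·e^{σ₀}` ∕ `2`); §2 **`mass_Vgh_le`** (the rescaled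
first ghost jet: centred `σn`-weighted mass `≤ n²·(4·C_{G₀}·(1+16∕(κ∕4))⁴·(2·e^{σ₀}))`), **`mass_Wgh_le`** (the rescaled ghost table at `(μ,0;ν,z)`: plain mass
`≤ (n²·4·W²·Zl 4 (κ∕4∕(8n))·2)·e^{−(κ∕4∕8)|z|₁}`), `mass_smul_plain_le`; §3 `KG_arith` (pure ℝ: the n-free majorant — `mV²·n⁻⁴` n-free, `mW·n⁻⁴ ≤ …·n⁻⁶`),
**`decay510_ghostWordK_road (hr) (ha) (i μ ν) : Decay510 (ghostWordK (Ggh n a) (Pgt n a) 𝒱gh 𝒲gh i μ ν) (KG a) (min (κ∕4∕8) σ₀)`** — J1's uniform row at §2's letters, n-FREE —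
and the two one-liners the OWNER's PART 13 applies BY NAME: `KG_road_nonneg (ha) : 0 ≤ KG a`, `kappaG_road_pos (ha) : 0 < min (κ∕4∕8) σ₀` (leaf-01 g24's remark R1).
Unit `b2b-balaban-beta-d1-formalise-leaf-04` (gen 20), road «BF-x»; INTENT 3 (journal [D1LEAF04-G20-INTENT-3]); letters by `b2b-balaban-gan24-formalise-leaf-05` (gen 53).
-/

noncomputable section

open Finset
open scoped BigOperators
open Literature.MathematicalPhysics.QuantumFieldTheory.Balaban1983to89
open Literature.MathematicalPhysics.QuantumFieldTheory.Balaban1983to89.Beta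
open B12Sec2to5 (l1 l1_nonneg Decay510)
open B4Sect5Proof (latticeConst latticeConst_nonneg)
open B5Hk163Strip (kappa163 kappa163_pos)
open B5Hk163Decay (MG163)
open B4TorusKernel (periodConst)
open ExpKernelCalculus (Site MKer Zl Zl_nonneg decay510_mono_const)
open AffineAveraging (box toSite unitVec)
open OneStepResolventKernel (wsum)
open OneStepKernelFamily (KInvStep colH)
open Summit.QuantumFields.BalabanUV.Beta.AxialDressingRooted (coDressKBmAt)
open Summit.QuantumFields.BalabanUV.Beta.D1BFx.RProjector (Pgt deltaPP deltaPP_pos)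
open Summit.QuantumFields.BalabanUV.Beta.D1BFx.ProjectorSupNorm (cPPs cPPs_nonneg)
open Summit.QuantumFields.BalabanUV.Beta.D1BFx.GhostLeg (Ggh const_nonneg)
open Summit.QuantumFields.BalabanUV.Beta.D1BFx.GhostLegFree (ghDelta ghDelta_pos)
open Summit.QuantumFields.BalabanUV.Beta.D1BFx.GhostLegBlockMass (cNear)
open Summit.QuantumFields.BalabanUV.Beta.D1BFx.RColumnBlockMass (cNear_nonneg)
open Summit.QuantumFields.BalabanUV.Beta.D1BFx.GhostStencil (ghCur l1_unitVec l1_zero)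
open Summit.QuantumFields.BalabanUV.Beta.D1BFx.TorusGhostPairStencils (gh₂)
open Summit.QuantumFields.BalabanUV.Beta.D1BFx.RestKernelGhostWords (GhIdx ghostWordK)
open Summit.QuantumFields.BalabanUV.Beta.D1BFx.RestKernelGhostUnit (sigma_facts)
open Summit.QuantumFields.BalabanUV.Beta.D1BFx.RestKernelGhostUnitJ (decay510_wordJ_uniform)
open Summit.QuantumFields.BalabanUV.Beta.D1BFx.RestKernelFPUnit (Zl_coarse_rate_le)
open Summit.QuantumFields.BalabanUV.Beta.D1BFx.GhostWordJetMass (mass_ghCur_le mass_gh₂_le mass_smul_le)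
open Summit.QuantumFields.BalabanUV.Beta.D1BFx.PackedColumnEnvelope (colH_G₀_road_weight_nonneg)
open Summit.QuantumFields.BalabanUV.Beta.D1BFx.PackedColumnJetMass (mass_sum_wsum_colH_G₀_le)
open Summit.QuantumFields.BalabanUV.Beta.D1BFx.PackedColumnTableMass (mass_sum_wsum_mul_colH_G₀_le)

namespace Summit.QuantumFields.BalabanUV.Beta.D1BFx.RestKernelGhostRoad

variable (m : ℕ) {a : ℝ} {r : Fin (3 + 1) → ℕ}

/-! ## §1 The stencils' masses -/

/-- [folklore] The centred `σ`-weighted mass of the ghost current `ghCur κ u` at its own index: `≤ 2·e^{σ}` for `0 ≤ σ` (two unit entries at `(u+e_κ, u)`, `(u, u+e_κ)`). -/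
theorem mass_ghCur_rate_le (σ : ℝ) (κ : Fin 4) (u : Site 4) :
    (Summable fun p : Site 4 × Site 4 => ∑ a, ∑ b, |ghCur κ u p.1 p.2 a b| * Real.exp (σ * (l1 (p.1 - u) + l1 (p.2 - u)))) ∧
      ∑' p : Site 4 × Site 4, ∑ a, ∑ b, |ghCur κ u p.1 p.2 a b| * Real.exp (σ * (l1 (p.1 - u) + l1 (p.2 - u))) ≤ 2 * Real.exp σ := by
  have h := mass_ghCur_le (W := fun p : Site 4 × Site 4 => Real.exp (σ * (l1 (p.1 - u) + l1 (p.2 - u)))) (fun p => (Real.exp_pos _).le) κ u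
  refine ⟨h.1, h.2.trans (le_of_eq ?_)⟩
  simp only [add_sub_cancel_left, sub_self, l1_unitVec, l1_zero, add_zero, zero_add, mul_one]
  ring

/-- [folklore] The plain mass of the pair table `gh₂ κ u`: `≤ 2`. -/
theorem mass_gh₂_plain_le (κ : Fin 4) (u : Site 4) :
    (Summable fun p : Site 4 × Site 4 => ∑ a, ∑ b, |gh₂ κ u p.1 p.2 a b|) ∧ ∑' p : Site 4 × Site 4, ∑ a, ∑ b, |gh₂ κ u p.1 p.2 a b| ≤ 2 := by
  have h := mass_gh₂_le (W := fun _ : Site 4 × Site 4 => (1 : ℝ)) (fun _ => zero_le_one) κ u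
  simp only [mul_one] at h
  exact ⟨h.1, h.2.trans (by norm_num)⟩

/-- [folklore] Scaling a kernel scales its PLAIN mass (`GhostWordJetMass.mass_smul_le` at the weight `1`). -/
theorem mass_smul_plain_le {F : Type*} [Fintype F] {c : ℝ} {K : MKer 4 F} {M : ℝ}
    (hKs : Summable fun p : Site 4 × Site 4 => ∑ g, ∑ f, |K p.1 p.2 g f|) (hKm : ∑' p : Site 4 × Site 4, ∑ g, ∑ f, |K p.1 p.2 g f| ≤ M) :
    (Summable fun p : Site 4 × Site 4 => ∑ g, ∑ f, |(c • K) p.1 p.2 g f|) ∧ ∑' p : Site 4 × Site 4, ∑ g, ∑ f, |(c • K) p.1 p.2 g f| ≤ |c| * M := by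
  have h := mass_smul_le (c := c) (K := K) (W := fun _ : Site 4 × Site 4 => (1 : ℝ)) (m := M)
    (by simpa only [mul_one] using hKs) (by simpa only [mul_one] using hKm)
  simpa only [mul_one] using h

/-! ## §2 The road's rescaled ghost jets: letters -/

section Jets

variable (hr : r ∈ box (3 + 1) (m + 1)) (ha : 0 < a)
include hr ha

/-- [folklore] **THE RESCALED FIRST GHOST JET's LETTER**: at the common rate `σn`, for every coarse bond `(κ′, v)`, the kernel
`n² • (x y a b ↦ Σ_κ wsum (colH G₀ n κ′ v κ) (ghCur κ) x y a b)` has centred weighted mass `≤ n²·(4·C_{G₀}·(1+16∕(κ∕4))⁴·(2·e^{σ₀}))` (summable). -/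
theorem mass_Vgh_le (κ' : Fin 4) (v : Site 4) :
    (Summable fun p : Site 4 × Site 4 => ∑ g, ∑ f,
        |((fun κ' v => (((m + 1 : ℕ) : ℝ) ^ 2) • (fun x y c b => ∑ κ : Fin 4,
            wsum (colH (coDressKBmAt (toSite r) (m + 1) (KInvStep (d := 3) (m + 1) 0)) (m + 1) κ' v κ) (ghCur κ) x y c b)) κ' v) p.1 p.2 g f|
          * Real.exp ((min (deltaPP 4 a / 8) (kappa163 (3 + 1) / (3 + 1) / 16) / ((m + 1 : ℕ) : ℝ))
            * (l1 (p.1 - ((m + 1 : ℕ) : ℤ) • v) + l1 (p.2 - ((m + 1 : ℕ) : ℤ) • v)))) ∧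
      ∑' p : Site 4 × Site 4, ∑ g, ∑ f,
        |((fun κ' v => (((m + 1 : ℕ) : ℝ) ^ 2) • (fun x y c b => ∑ κ : Fin 4,
            wsum (colH (coDressKBmAt (toSite r) (m + 1) (KInvStep (d := 3) (m + 1) 0)) (m + 1) κ' v κ) (ghCur κ) x y c b)) κ' v) p.1 p.2 g f|
          * Real.exp ((min (deltaPP 4 a / 8) (kappa163 (3 + 1) / (3 + 1) / 16) / ((m + 1 : ℕ) : ℝ))
            * (l1 (p.1 - ((m + 1 : ℕ) : ℤ) • v) + l1 (p.2 - ((m + 1 : ℕ) : ℤ) • v)))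
        ≤ (((m + 1 : ℕ) : ℝ) ^ 2) * (4 * ((MG163 4 * periodConst (kappa163 4) 3) * (1 + 8 * (1 + Real.exp (kappa163 4 / 4))) * Real.exp (kappa163 4 / 4))
            * (1 + 16 / (kappa163 4 / 4)) ^ 4 * (2 * Real.exp (min (deltaPP 4 a / 8) (kappa163 (3 + 1) / (3 + 1) / 16)))) := by
  obtain ⟨hσ0, hσκ, -, -, hσN, hσ₀⟩ := sigma_facts m ha
  have hn : (0 : ℝ) < ((m + 1 : ℕ) : ℝ) := Nat.cast_pos.mpr (Nat.succ_pos m)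
  have hn1 : (1 : ℝ) ≤ ((m + 1 : ℕ) : ℝ) := by exact_mod_cast Nat.le_add_left 1 m
  -- the common rate is below the column envelope's ceiling `κ∕4∕(16n)` (`(3+1) = 4`)
  have hσκ' : min (deltaPP 4 a / 8) (kappa163 (3 + 1) / (3 + 1) / 16) / ((m + 1 : ℕ) : ℝ) ≤ kappa163 4 / 4 / (16 * ((m + 1 : ℕ) : ℝ)) := by
    have e : kappa163 (3 + 1) / (3 + 1) / (16 * ((m + 1 : ℕ) : ℝ)) = kappa163 4 / 4 / (16 * ((m + 1 : ℕ) : ℝ)) := by norm_num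
    rw [← e]; exact hσκ
  -- `σn ≤ σ₀`
  have hσle : min (deltaPP 4 a / 8) (kappa163 (3 + 1) / (3 + 1) / 16) / ((m + 1 : ℕ) : ℝ) ≤ min (deltaPP 4 a / 8) (kappa163 (3 + 1) / (3 + 1) / 16) :=
    div_le_self hσ₀.le hn1
  -- the stencil masses at the common rate: `2·e^{σn} ≤ 2·e^{σ₀}`
  have hT := fun κ u => mass_ghCur_rate_le (min (deltaPP 4 a / 8) (kappa163 (3 + 1) / (3 + 1) / 16) / ((m + 1 : ℕ) : ℝ)) κ u
  have hTm : ∀ κ u, ∑' p : Site 4 × Site 4, ∑ g, ∑ f, |ghCur κ u p.1 p.2 g f|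
      * Real.exp ((min (deltaPP 4 a / 8) (kappa163 (3 + 1) / (3 + 1) / 16) / ((m + 1 : ℕ) : ℝ)) * (l1 (p.1 - u) + l1 (p.2 - u)))
        ≤ 2 * Real.exp (min (deltaPP 4 a / 8) (kappa163 (3 + 1) / (3 + 1) / 16)) := fun κ u =>
    (hT κ u).2.trans (mul_le_mul_of_nonneg_left (Real.exp_le_exp.mpr hσle) (by norm_num))
  have hJ := mass_sum_wsum_colH_G₀_le m hr (T := fun κ u => ghCur κ u) hσ0 hσκ' (fun κ u => (hT κ u).1) hTm κ' v
  -- the lambda form of the jet IS the `Finset.sum` of functions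
  have e : (fun x y a b => ∑ κ : Fin 4, wsum (colH (coDressKBmAt (toSite r) (m + 1) (KInvStep (d := 3) (m + 1) 0)) (m + 1) κ' v κ) (ghCur κ) x y a b)
      = ∑ κ : Fin 4, wsum (colH (coDressKBmAt (toSite r) (m + 1) (KInvStep (d := 3) (m + 1) 0)) (m + 1) κ' v κ) (fun u => ghCur κ u) := by
    funext x y a b; simp only [Finset.sum_apply]
  have hS := mass_smul_le (c := (((m + 1 : ℕ) : ℝ) ^ 2)) hJ.1 hJ.2
  rw [← e] at hS
  rw [abs_of_nonneg (by positivity)] at hS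
  exact hS

omit ha in
/-- [folklore] **THE RESCALED GHOST TABLE's LETTER** at the base bonds `(μ, 0; ν, z)`: plain mass `≤ (n²·4·W·W·Zl 4 (κ∕4∕(8n))·2)·e^{−(κ∕4∕8)|z|₁}` (summable), `W = (n⁴)⁻¹·C_{G₀}`. -/
theorem mass_Wgh_le (μ ν : Fin 4) (z : Site 4) :
    (Summable fun p : Site 4 × Site 4 => ∑ g, ∑ b,
        |((fun κ' v l v' => (((m + 1 : ℕ) : ℝ) ^ 2) • (fun x y c b => ∑ κ : Fin 4,
            wsum (colH (coDressKBmAt (toSite r) (m + 1) (KInvStep (d := 3) (m + 1) 0)) (m + 1) κ' v κ)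
              (fun u => fun x y c b => colH (coDressKBmAt (toSite r) (m + 1) (KInvStep (d := 3) (m + 1) 0)) (m + 1) l v' κ u * gh₂ κ u x y c b) x y c b))
          μ 0 ν z) p.1 p.2 g b|) ∧
      ∑' p : Site 4 × Site 4, ∑ g, ∑ b,
        |((fun κ' v l v' => (((m + 1 : ℕ) : ℝ) ^ 2) • (fun x y c b => ∑ κ : Fin 4,
            wsum (colH (coDressKBmAt (toSite r) (m + 1) (KInvStep (d := 3) (m + 1) 0)) (m + 1) κ' v κ)
              (fun u => fun x y c b => colH (coDressKBmAt (toSite r) (m + 1) (KInvStep (d := 3) (m + 1) 0)) (m + 1) l v' κ u * gh₂ κ u x y c b) x y c b))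
          μ 0 ν z) p.1 p.2 g b|
        ≤ ((((m + 1 : ℕ) : ℝ) ^ 2) * (4 * (((((m + 1 : ℕ) : ℝ) ^ 4)⁻¹ * ((MG163 4 * periodConst (kappa163 4) 3)
              * (1 + 8 * (1 + Real.exp (kappa163 4 / 4))) * Real.exp (kappa163 4 / 4)))
          * ((((m + 1 : ℕ) : ℝ) ^ 4)⁻¹ * ((MG163 4 * periodConst (kappa163 4) 3)
              * (1 + 8 * (1 + Real.exp (kappa163 4 / 4))) * Real.exp (kappa163 4 / 4)))
          * Zl 4 (kappa163 4 / 4 / (8 * ((m + 1 : ℕ) : ℝ)))) * 2))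
          * Real.exp (-(kappa163 4 / 4 / 8) * l1 z) := by
  have hT := fun κ u => mass_gh₂_plain_le κ u
  have hJ := mass_sum_wsum_mul_colH_G₀_le m hr (T := fun κ u => gh₂ κ u) (fun κ u => (hT κ u).1) (fun κ u => (hT κ u).2) μ 0 ν z
  rw [sub_zero] at hJ
  have e : (fun x y a b => ∑ κ : Fin 4, wsum (colH (coDressKBmAt (toSite r) (m + 1) (KInvStep (d := 3) (m + 1) 0)) (m + 1) μ 0 κ)
        (fun u => fun x y a b => colH (coDressKBmAt (toSite r) (m + 1) (KInvStep (d := 3) (m + 1) 0)) (m + 1) ν z κ u * gh₂ κ u x y a b) x y a b)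
      = ∑ κ : Fin 4, wsum (colH (coDressKBmAt (toSite r) (m + 1) (KInvStep (d := 3) (m + 1) 0)) (m + 1) μ 0 κ)
        (fun u => fun x y a b => colH (coDressKBmAt (toSite r) (m + 1) (KInvStep (d := 3) (m + 1) 0)) (m + 1) ν z κ u * gh₂ κ u x y a b) := by
    funext x y a b; simp only [Finset.sum_apply]
  have hS := mass_smul_plain_le (c := (((m + 1 : ℕ) : ℝ) ^ 2)) hJ.1 hJ.2
  rw [← e, abs_of_nonneg (by positivity)] at hS
  refine ⟨hS.1, hS.2.trans (le_of_eq (by ring))⟩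

end Jets

/-! ## §3 The twelve rows at the road, n-free -/

/-- [folklore] Pure arithmetic: the n-free majorant of J1's uniform constant at the road's letters (`Z ≤ n⁴·k` is `Zl 4 (κ∕4∕(8n)) ≤ n⁴(1+64∕κ)⁴`):
the table part is `≤ ½·P·M·8·C₀²·k` (an `n⁻⁶` spared), the bubble part is EXACTLY `½·B·(8·C₀·Q·E)²`. -/
theorem KG_arith {n P M B C₀ Q E Z k : ℝ} (hn : 1 ≤ n) (hP : 0 ≤ P) (hM : 0 ≤ M) (hZ : Z ≤ n ^ 4 * k) (hk : 0 ≤ k) :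
    (n ^ 4)⁻¹ * ((1 / 2) * (P * M) * (n ^ 2 * (4 * ((n ^ 4)⁻¹ * C₀ * ((n ^ 4)⁻¹ * C₀) * Z) * 2))
        + (1 / 2) * B * (n ^ 2 * (4 * C₀ * Q * (2 * E))) * (n ^ 2 * (4 * C₀ * Q * (2 * E))))
      ≤ (1 / 2) * (P * M) * (8 * C₀ ^ 2 * k) + (1 / 2) * B * (8 * C₀ * Q * E) ^ 2 := by
  have hn0 : 0 < n := by linarith
  have hn6 : (1 : ℝ) ≤ n ^ 6 := one_le_pow₀ hn
  have e : (n ^ 4)⁻¹ * ((1 / 2) * (P * M) * (n ^ 2 * (4 * ((n ^ 4)⁻¹ * C₀ * ((n ^ 4)⁻¹ * C₀) * Z) * 2))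
        + (1 / 2) * B * (n ^ 2 * (4 * C₀ * Q * (2 * E))) * (n ^ 2 * (4 * C₀ * Q * (2 * E))))
      = (1 / 2) * (P * M) * (8 * C₀ ^ 2) * (Z / n ^ 10) + (1 / 2) * B * (8 * C₀ * Q * E) ^ 2 := by
    field_simp; ring
  rw [e]
  have hZ' : Z / n ^ 10 ≤ k := by
    rw [div_le_iff₀ (by positivity)]
    calc Z ≤ n ^ 4 * k := hZ
      _ ≤ n ^ 10 * k := by
          refine mul_le_mul_of_nonneg_right ?_ hk
          calc n ^ 4 = n ^ 4 * 1 := (mul_one _).symm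
            _ ≤ n ^ 4 * n ^ 6 := mul_le_mul_of_nonneg_left hn6 (by positivity)
            _ = n ^ 10 := by ring
      _ = k * n ^ 10 := mul_comm _ _
  have h1 : (1 / 2) * (P * M) * (8 * C₀ ^ 2) * (Z / n ^ 10) ≤ (1 / 2) * (P * M) * (8 * C₀ ^ 2) * k :=
    mul_le_mul_of_nonneg_left hZ' (by positivity)
  linarith

section Road

variable (hr : r ∈ box (3 + 1) (m + 1)) (ha : 0 < a)
include hr ha

/-- [folklore] **THE TWELVE GHOST WORDS AT THE ROAD's GAUGED JETS ARE (5.10)-KERNELS WITH ONE n-FREE CONSTANT AND ONE n-FREE RATE** — the OWNER's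
PART 12b binders `hgh hKg hκg` at `Kg := fun _ => KG a`, `κg := min (κ∕4∕8) σ₀` (`KG a := ½·cPPs·MG·8·C_{G₀}²·(1+64∕κ)⁴ + ½·KB(a)·(8·C_{G₀}·(1+16∕(κ∕4))⁴·e^{σ₀})²`,
J1's `KB`; jets = PART 12a's `Vgh r (m+1)` ∕ `Wgh r (m+1)` right members at a fixed in-block root). -/
theorem decay510_ghostWordK_road (i : GhIdx) (μ ν : Fin 4) :
    Decay510 (ghostWordK (Ggh (m + 1) a) (Pgt (m + 1) a)
        (fun κ' v => (((m + 1 : ℕ) : ℝ) ^ 2) • (fun x y c b => ∑ κ : Fin 4,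
            wsum (colH (coDressKBmAt (toSite r) (m + 1) (KInvStep (d := 3) (m + 1) 0)) (m + 1) κ' v κ) (ghCur κ) x y c b))
        (fun κ' v l v' => (((m + 1 : ℕ) : ℝ) ^ 2) • (fun x y c b => ∑ κ : Fin 4,
            wsum (colH (coDressKBmAt (toSite r) (m + 1) (KInvStep (d := 3) (m + 1) 0)) (m + 1) κ' v κ)
              (fun u => fun x y c b => colH (coDressKBmAt (toSite r) (m + 1) (KInvStep (d := 3) (m + 1) 0)) (m + 1) l v' κ u * gh₂ κ u x y c b) x y c b))
        i μ ν)
      ((1 / 2) * (cPPs 4 a * (cNear a * latticeConst 4 (ghDelta a)))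
          * (8 * ((MG163 4 * periodConst (kappa163 4) 3) * (1 + 8 * (1 + Real.exp (kappa163 4 / 4))) * Real.exp (kappa163 4 / 4)) ^ 2
              * (1 + 64 / kappa163 4) ^ 4)
        + (1 / 2) * ((2 / min 2 a * (cNear a * latticeConst 4 (ghDelta a))) * (cPPs 4 a * Real.exp (deltaPP 4 a))
            + (2 / min 2 a) * (cPPs 4 a * (cNear a * latticeConst 4 (ghDelta a)))
            + (cPPs 4 a * Real.exp (deltaPP 4 a) * (2 / min 2 a) * (1 + 16 / deltaPP 4 a) ^ 4) * (cPPs 4 a * (cNear a * latticeConst 4 (ghDelta a)))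
            + (cPPs 4 a * Real.exp (deltaPP 4 a)) * ((cNear a * latticeConst 4 (ghDelta a)) * (cPPs 4 a * (cNear a * latticeConst 4 (ghDelta a)))))
          * (8 * ((MG163 4 * periodConst (kappa163 4) 3) * (1 + 8 * (1 + Real.exp (kappa163 4 / 4))) * Real.exp (kappa163 4 / 4))
              * (1 + 16 / (kappa163 4 / 4)) ^ 4 * Real.exp (min (deltaPP 4 a / 8) (kappa163 (3 + 1) / (3 + 1) / 16))) ^ 2)
      (min (kappa163 4 / 4 / 8) (min (deltaPP 4 a / 8) (kappa163 (3 + 1) / (3 + 1) / 16))) := by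
  have hC₀ : 0 ≤ (MG163 4 * periodConst (kappa163 4) 3) * (1 + 8 * (1 + Real.exp (kappa163 4 / 4))) * Real.exp (kappa163 4 / 4) := by
    have h0 := colH_G₀_road_weight_nonneg 0
    have h1 : (0 : ℝ) < (((0 + 1 : ℕ) : ℝ) ^ 4)⁻¹ := by norm_num
    exact (mul_nonneg_iff_of_pos_left h1).1 h0
  have h := decay510_wordJ_uniform (m := m) ha (μ := μ) (ν := ν)
    (𝒱 := fun κ' v => (((m + 1 : ℕ) : ℝ) ^ 2) • (fun x y c b => ∑ κ : Fin 4,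
            wsum (colH (coDressKBmAt (toSite r) (m + 1) (KInvStep (d := 3) (m + 1) 0)) (m + 1) κ' v κ) (ghCur κ) x y c b))
    (𝒲 := fun κ' v l v' => (((m + 1 : ℕ) : ℝ) ^ 2) • (fun x y c b => ∑ κ : Fin 4,
            wsum (colH (coDressKBmAt (toSite r) (m + 1) (KInvStep (d := 3) (m + 1) 0)) (m + 1) κ' v κ)
              (fun u => fun x y c b => colH (coDressKBmAt (toSite r) (m + 1) (KInvStep (d := 3) (m + 1) 0)) (m + 1) l v' κ u * gh₂ κ u x y c b) x y c b))
    (fun κ' v => (mass_Vgh_le m hr ha κ' v).1) (fun κ' v => (mass_Vgh_le m hr ha κ' v).2)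
    (fun z => (mass_Wgh_le m hr μ ν z).1) (fun z => (mass_Wgh_le m hr μ ν z).2) (by have := hC₀; positivity) i
  refine decay510_mono_const h ?_
  have hn1 : (1 : ℝ) ≤ ((m + 1 : ℕ) : ℝ) := by exact_mod_cast Nat.le_add_left 1 m
  haveI : NeZero (m + 1) := ⟨Nat.succ_ne_zero m⟩
  have hM0 : 0 ≤ cNear a * latticeConst 4 (ghDelta a) := by
    have := cNear_nonneg ha; have := latticeConst_nonneg 4 (ghDelta_pos ha).le; positivity
  have hk : 0 < kappa163 4 := kappa163_pos 4
  have hZ : Zl 4 (kappa163 4 / 4 / (8 * ((m + 1 : ℕ) : ℝ))) ≤ ((m + 1 : ℕ) : ℝ) ^ 4 * (1 + 64 / kappa163 4) ^ 4 := by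
    refine (Zl_coarse_rate_le (n := m + 1) (δ₀ := kappa163 4 / 4) (c := 8) (by positivity) (by norm_num)).trans (le_of_eq ?_)
    rw [show (2 : ℝ) * 8 / (kappa163 4 / 4) = 64 / kappa163 4 by field_simp; ring]
  exact KG_arith (n := ((m + 1 : ℕ) : ℝ)) (P := cPPs 4 a) (M := cNear a * latticeConst 4 (ghDelta a))
    (B := (2 / min 2 a * (cNear a * latticeConst 4 (ghDelta a))) * (cPPs 4 a * Real.exp (deltaPP 4 a))
            + (2 / min 2 a) * (cPPs 4 a * (cNear a * latticeConst 4 (ghDelta a)))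
            + (cPPs 4 a * Real.exp (deltaPP 4 a) * (2 / min 2 a) * (1 + 16 / deltaPP 4 a) ^ 4) * (cPPs 4 a * (cNear a * latticeConst 4 (ghDelta a)))
            + (cPPs 4 a * Real.exp (deltaPP 4 a)) * ((cNear a * latticeConst 4 (ghDelta a)) * (cPPs 4 a * (cNear a * latticeConst 4 (ghDelta a)))))
    (C₀ := (MG163 4 * periodConst (kappa163 4) 3) * (1 + 8 * (1 + Real.exp (kappa163 4 / 4))) * Real.exp (kappa163 4 / 4))
    (Q := (1 + 16 / (kappa163 4 / 4)) ^ 4) (E := Real.exp (min (deltaPP 4 a / 8) (kappa163 (3 + 1) / (3 + 1) / 16)))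
    (Z := Zl 4 (kappa163 4 / 4 / (8 * ((m + 1 : ℕ) : ℝ)))) (k := (1 + 64 / kappa163 4) ^ 4)
    hn1 (cPPs_nonneg 4 ha) hM0 hZ (by positivity)

omit hr in
/-- [folklore] The road's ghost (5.10) constant `KG a` is nonnegative (the OWNER's 12b binder `hKg : ∀ i, 0 ≤ Kg i` at `Kg := fun _ => KG a`, BY NAME). -/
theorem KG_road_nonneg :
    0 ≤ (1 / 2) * (cPPs 4 a * (cNear a * latticeConst 4 (ghDelta a)))
          * (8 * ((MG163 4 * periodConst (kappa163 4) 3) * (1 + 8 * (1 + Real.exp (kappa163 4 / 4))) * Real.exp (kappa163 4 / 4)) ^ 2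
              * (1 + 64 / kappa163 4) ^ 4)
        + (1 / 2) * ((2 / min 2 a * (cNear a * latticeConst 4 (ghDelta a))) * (cPPs 4 a * Real.exp (deltaPP 4 a))
            + (2 / min 2 a) * (cPPs 4 a * (cNear a * latticeConst 4 (ghDelta a)))
            + (cPPs 4 a * Real.exp (deltaPP 4 a) * (2 / min 2 a) * (1 + 16 / deltaPP 4 a) ^ 4) * (cPPs 4 a * (cNear a * latticeConst 4 (ghDelta a)))
            + (cPPs 4 a * Real.exp (deltaPP 4 a)) * ((cNear a * latticeConst 4 (ghDelta a)) * (cPPs 4 a * (cNear a * latticeConst 4 (ghDelta a)))))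
          * (8 * ((MG163 4 * periodConst (kappa163 4) 3) * (1 + 8 * (1 + Real.exp (kappa163 4 / 4))) * Real.exp (kappa163 4 / 4))
              * (1 + 16 / (kappa163 4 / 4)) ^ 4 * Real.exp (min (deltaPP 4 a / 8) (kappa163 (3 + 1) / (3 + 1) / 16))) ^ 2 := by
  have := cPPs_nonneg 4 ha; have := cNear_nonneg ha; have := latticeConst_nonneg 4 (ghDelta_pos ha).le
  have := kappa163_pos 4; have := deltaPP_pos 4 ha
  have : 0 < min 2 a := lt_min (by norm_num) ha
  positivity

omit hr in
/-- [folklore] The road's ghost (5.10) rate `κg := min (κ∕4∕8) σ₀` is positive (the OWNER's 12b binder `hκg : 0 < κg`, BY NAME). -/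
theorem kappaG_road_pos : 0 < min (kappa163 4 / 4 / 8) (min (deltaPP 4 a / 8) (kappa163 (3 + 1) / (3 + 1) / 16)) := by
  have := kappa163_pos 4; have := deltaPP_pos 4 ha; have := kappa163_pos (3 + 1)
  exact lt_min (by positivity) (lt_min (by positivity) (by positivity))

end Road

end Summit.QuantumFields.BalabanUV.Beta.D1BFx.RestKernelGhostRoad

end
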